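import Summits.NavierStokesRegularity.NavierStokesRegularity.Theorems.SymmetryModuliCountSymmetricLiouvilleRotationCovariance
import Summits.NavierStokesRegularity.NavierStokesRegularity.Theorems.SymmetryModuliCountAxisymEndLiouvilleStubAxisNormalForm
import Literature.Analysis.FluidPDE.TypeIAncientMild
import Literature.Analysis.FluidPDE.SwirlTransportProofs
import Literature.Analysis.FluidPDE.WeakSolution
import Literature.Analysis.FluidPDE.SelfSimilar
import HarnessLib

/-!
# Route TypeICertificateLadder — crux `Target` (item stmt-NavierStokesRegularity-1217),
# line `killing-twisted-bernoulli-solitons`: axis normal form of a spiral-symmetric rate-class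
# element (sub-goal SB4b, stub `solitonBridge_axisNormalForm`)

Helper file (theorems only). Let `u` be an element of the rate class `A_C`
(`IsTypeIAncientMild C u`: jointly `C^∞` on the open slab `(−∞, 0) × ℝ³`, divergence free,
Oseen-mild, `‖u‖ ≤ C/√(−t)`) with the apex bound `HasTypeIDecay K u`
(`‖u t x‖ ≤ K/(‖x‖ + √(−t))`), annihilated at every `(t, x)`, `t < 0`, by the spiral-scaling
generator `D(u t)(x)[x + A x] + u t x + 2t ∂ₜu(t, x) − A (u t x) = 0` of an ARBITRARY nonzero skew
map `A` of `ℝ³` (any axis through the origin, any rate). Then, after conjugation by a suitable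
linear isometry `L` of `ℝ³`, the field `ũ(t, x) = L (u t (L⁻¹ x))` is again in `A_C`, keeps the
apex bound with the same constant, and satisfies the generator clause with the NORMALISED skew map
`A' = (−2α) J`, `α ≠ 0`, `J = rotGenL` the generator of the rotations about the vertical axis `e₃`
— the form of the clause for Pineau–Vicol's rotated self-similar ansatz `pvAnsatz α U`
(arXiv:2607.09619, (1.7)), consumed by the sibling stub `solitonBridge_pvAnsatz_of_generator`.

## Proof

Linear algebra (`exists_conj_eq_smul_rotGen`, tree): a nonzero skew map of `ℝ³` is conjugate by a
linear isometry to `β J` with `β ≠ 0`; put `α = −β/2`. The class `A_C` is invariant under linear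
isometries (`isTypeIAncientMild_conj_linearIsometryEquiv`, tree), the apex bound is too
(`‖L w‖ = ‖w‖`, `‖L⁻¹ x‖ = ‖x‖`), and the generator is covariant: by the chain rule
`D(ũ t)(x)[h] = L (D(u t)(L⁻¹ x)[L⁻¹ h])`, `∂ₜũ(t, x) = L (∂ₜu(t, L⁻¹ x))`, while
`L⁻¹ (x + A' x) = L⁻¹ x + A (L⁻¹ x)` and `A' (L w) = L (A w)` because `L A L⁻¹ = β J = A'`; hence
`generator(ũ)(t, x) = L (generator(u)(t, L⁻¹ x)) = 0`.

All statements are folklore linear algebra and calculus.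

## References

* B. Pineau, V. Vicol, arXiv:2607.09619 (2026): §1.2, (1.6)–(1.7). [PineauVicol2026]
* G. Koch, N. Nadirashvili, G. Seregin, V. Šverák, Acta Math. 203 (2009) = arXiv:0709.3599, §1
  (symmetries of the problem). [KochNadirashviliSereginSverak2009]
-/

noncomputable section

-- the summit and its single sub-problem share the name (CONVENTIONS §1), as in every Theorems file
set_option linter.dupNamespace false

namespace Summit.NavierStokesRegularity.NavierStokesRegularity.Theorems

open Set Function Filter
open scoped Topology ContDiff RealInnerProductSpace
open Literature.Analysis.FluidPDE
open SymmetryModuliCountSymmetricLiouville (isTypeIAncientMild_conj_linearIsometryEquiv)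
open AxisymEndLiouville.AbsorbingAxisSwirlExtinction (exists_conj_eq_smul_rotGen)

/-! ## Conjugation calculus -/

/-- The derivative of a conjugate field, applied: `D(L φ L⁻¹)(y) h = L (Dφ(L⁻¹ y) (L⁻¹ h))`
(chain rule through the continuous linear equivalences `L`, `L⁻¹`). [folklore] -/
private theorem solitonBridge_nf_fderiv_conj_apply
    (L : EuclideanSpace ℝ (Fin 3) ≃ₗᵢ[ℝ] EuclideanSpace ℝ (Fin 3))
    {φ : EuclideanSpace ℝ (Fin 3) → EuclideanSpace ℝ (Fin 3)} (hd : Differentiable ℝ φ)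
    (y h : EuclideanSpace ℝ (Fin 3)) :
    fderiv ℝ (fun z => L (φ (L.symm z))) y h = L (fderiv ℝ φ (L.symm y) (L.symm h)) := by
  have hC : HasFDerivAt (fun z : EuclideanSpace ℝ (Fin 3) => L z)
      (L.toContinuousLinearEquiv : EuclideanSpace ℝ (Fin 3) →L[ℝ] EuclideanSpace ℝ (Fin 3))
      (φ (L.symm y)) :=
    L.toContinuousLinearEquiv.hasFDerivAt
  have hcomp : HasFDerivAt (fun z => L (φ (L.symm z)))
      ((L.toContinuousLinearEquiv : EuclideanSpace ℝ (Fin 3) →L[ℝ] EuclideanSpace ℝ (Fin 3)).comp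
        ((fderiv ℝ φ (L.symm y)).comp
          (L.symm.toContinuousLinearEquiv :
            EuclideanSpace ℝ (Fin 3) →L[ℝ] EuclideanSpace ℝ (Fin 3)))) y :=
    (hC.comp (L.symm y) (hd _).hasFDerivAt).comp y L.symm.toContinuousLinearEquiv.hasFDerivAt
  rw [hcomp.fderiv]
  rfl

/-- Time slices of a class element are differentiable in time at every negative time (the joint
smoothness on the open slab, restricted along `r ↦ (r, x)`). [folklore] -/
private theorem solitonBridge_nf_differentiableAt_time {C : ℝ}
    {u : ℝ → EuclideanSpace ℝ (Fin 3) → EuclideanSpace ℝ (Fin 3)} (hu : IsTypeIAncientMild C u)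
    {t : ℝ} (ht : t < 0) (x : EuclideanSpace ℝ (Fin 3)) :
    DifferentiableAt ℝ (fun r => u r x) t := by
  -- adapted from Theorems/SymmetryModuliCountSymmetricLiouvilleRssFarField.lean
  have h1 : ContDiffAt ℝ (⊤ : ℕ∞) (uncurry u) (t, x) :=
    hu.contDiffOn.contDiffAt ((isOpen_Iio.prod isOpen_univ).mem_nhds ⟨ht, mem_univ _⟩)
  have h2 : ContDiffAt ℝ (⊤ : ℕ∞) (fun r : ℝ => (r, x)) t :=
    (contDiff_id.prodMk contDiff_const).contDiffAt
  exact (h1.comp t h2).differentiableAt (by simp)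

/-- The time derivative of a conjugate field: `∂ₜ(L u L⁻¹)(t, x) = L (∂ₜu (t, L⁻¹ x))` at every
`t < 0` (the continuous linear map `L` commutes with `d/dt`). [folklore] -/
private theorem solitonBridge_nf_timeDeriv_conj {C : ℝ}
    {u : ℝ → EuclideanSpace ℝ (Fin 3) → EuclideanSpace ℝ (Fin 3)} (hu : IsTypeIAncientMild C u)
    (L : EuclideanSpace ℝ (Fin 3) ≃ₗᵢ[ℝ] EuclideanSpace ℝ (Fin 3)) {t : ℝ} (ht : t < 0)
    (x : EuclideanSpace ℝ (Fin 3)) :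
    timeDeriv (fun s y => L (u s (L.symm y))) t x = L (timeDeriv u t (L.symm x)) := by
  rw [timeDeriv_apply, timeDeriv_apply]
  have hd : HasDerivAt (fun s => u s (L.symm x)) (deriv (fun s => u s (L.symm x)) t) t :=
    (solitonBridge_nf_differentiableAt_time hu ht (L.symm x)).hasDerivAt
  have hC : HasFDerivAt (fun z : EuclideanSpace ℝ (Fin 3) => L z)
      (L.toContinuousLinearEquiv : EuclideanSpace ℝ (Fin 3) →L[ℝ] EuclideanSpace ℝ (Fin 3))
      (u t (L.symm x)) :=
    L.toContinuousLinearEquiv.hasFDerivAt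
  exact (hC.comp_hasDerivAt t hd).deriv

/-- The apex Type-I bound is invariant under conjugation by a linear isometry
(`‖L w‖ = ‖w‖`, `‖L⁻¹ x‖ = ‖x‖`). [folklore] -/
private theorem solitonBridge_nf_hasTypeIDecay_conj {K : ℝ}
    {u : ℝ → EuclideanSpace ℝ (Fin 3) → EuclideanSpace ℝ (Fin 3)} (hK : HasTypeIDecay K u)
    (L : EuclideanSpace ℝ (Fin 3) ≃ₗᵢ[ℝ] EuclideanSpace ℝ (Fin 3)) :
    HasTypeIDecay K (fun t x => L (u t (L.symm x))) := by
  intro t ht x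
  have h := hK t ht (L.symm x)
  rw [LinearIsometryEquiv.norm_map] at h
  rwa [LinearIsometryEquiv.norm_map]

/-- **Covariance of the spiral-scaling generator under a conjugating isometry.** If
`L A L⁻¹ = β J` and the slice `u t` is annihilated by the generator with skew part `A` at
`L⁻¹ x`, then the conjugate field `L u L⁻¹` is annihilated by the generator with skew part
`β • rotGenL` at `x`. [folklore] -/
private theorem solitonBridge_nf_generator_conj {C : ℝ}
    {u : ℝ → EuclideanSpace ℝ (Fin 3) → EuclideanSpace ℝ (Fin 3)} (hu : IsTypeIAncientMild C u)
    (L : EuclideanSpace ℝ (Fin 3) ≃ₗᵢ[ℝ] EuclideanSpace ℝ (Fin 3))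
    {A : EuclideanSpace ℝ (Fin 3) →L[ℝ] EuclideanSpace ℝ (Fin 3)} {β : ℝ}
    (hconj : ∀ y, L (A (L.symm y)) = β • rotGen y) {t : ℝ} (ht : t < 0)
    (x : EuclideanSpace ℝ (Fin 3))
    (hgen : fderiv ℝ (u t) (L.symm x) (L.symm x + A (L.symm x)) + u t (L.symm x) +
      (2 * t) • timeDeriv u t (L.symm x) - A (u t (L.symm x)) = 0) :
    fderiv ℝ (fun y => L (u t (L.symm y))) x (x + (β • rotGenL) x) + L (u t (L.symm x)) +
      (2 * t) • timeDeriv (fun s y => L (u s (L.symm y))) t x -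
        (β • rotGenL) (L (u t (L.symm x))) = 0 := by
  have hd : Differentiable ℝ (u t) := (hu.contDiff_slice ht).differentiable (by simp)
  have e1 : ∀ w : EuclideanSpace ℝ (Fin 3), (β • rotGenL) w = β • rotGen w := fun w => rfl
  have e2 : L.symm (β • rotGen x) = A (L.symm x) := by
    apply L.injective
    rw [L.apply_symm_apply, hconj x]
  have e3 : β • rotGen (L (u t (L.symm x))) = L (A (u t (L.symm x))) := by
    rw [← hconj, L.symm_apply_apply]
  rw [solitonBridge_nf_fderiv_conj_apply L hd, map_add L.symm, e1 x, e2,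
    solitonBridge_nf_timeDeriv_conj hu L ht, e1, e3, ← L.map_smul, ← map_add, ← map_add,
    ← map_sub, hgen, map_zero]

/-! ## The stub -/

/-- **SB4b — axis normal form of a spiral-symmetric rate-class element.** For `u ∈ A_C` with the
apex bound `HasTypeIDecay K u`, annihilated on `t < 0` by the spiral-scaling generator
`D(u t)(x)[x + A x] + u t x + 2t ∂ₜu − A (u t x)` of a nonzero skew `A`, there are a linear
isometry `L` of `ℝ³` and `α ≠ 0` such that `ũ(t, x) = L (u t (L⁻¹ x))` lies in `A_C`, keeps the
apex bound, and is annihilated by the generator with the normalised skew part `(−2α) J`,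
`J = rotGenL` (`L A L⁻¹ = β J`, `β ≠ 0`, `α = −β/2`; covariance of the class, of the apex bound
and of the generator under linear isometries). [folklore] -/
theorem solitonBridge_axisNormalForm : ∀ (C K : ℝ) (u : ℝ → EuclideanSpace ℝ (Fin 3) → EuclideanSpace ℝ (Fin 3)) (A : EuclideanSpace ℝ (Fin 3) →L[ℝ] EuclideanSpace ℝ (Fin 3)), Literature.Analysis.FluidPDE.IsTypeIAncientMild C u → (∀ x : EuclideanSpace ℝ (Fin 3), inner ℝ (A x) x = 0) → A ≠ 0 → (∀ t < 0, ∀ x : EuclideanSpace ℝ (Fin 3), fderiv ℝ (u t) x (x + A x) + u t x + (2 * t) • Literature.Analysis.FluidPDE.timeDeriv u t x - A (u t x) = 0) → Literature.Analysis.FluidPDE.HasTypeIDecay K u → ∃ (L : EuclideanSpace ℝ (Fin 3) ≃ₗᵢ[ℝ] EuclideanSpace ℝ (Fin 3)) (α : ℝ), α ≠ 0 ∧ Literature.Analysis.FluidPDE.IsTypeIAncientMild C (fun t x => L (u t (L.symm x))) ∧ Literature.Analysis.FluidPDE.HasTypeIDecay K (fun t x => L (u t (L.symm x))) ∧ (∀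 t < 0, ∀ x : EuclideanSpace ℝ (Fin 3), fderiv ℝ (fun y => L (u t (L.symm y))) x (x + ((-(2 * α)) • Literature.Analysis.FluidPDE.rotGenL) x) + L (u t (L.symm x)) + (2 * t) • Literature.Analysis.FluidPDE.timeDeriv (fun s y => L (u s (L.symm y))) t x - ((-(2 * α)) • Literature.Analysis.FluidPDE.rotGenL) (L (u t (L.symm x))) = 0) := by
  intro C K u A hu hskew hA hgen hK
  obtain ⟨L, β, hβ, hconj⟩ := exists_conj_eq_smul_rotGen hskew hA
  have hα : -(2 * (-β / 2)) = β := by ring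
  refine ⟨L, -β / 2, div_ne_zero (neg_ne_zero.2 hβ) two_ne_zero,
    isTypeIAncientMild_conj_linearIsometryEquiv hu L, solitonBridge_nf_hasTypeIDecay_conj hK L,
    fun t ht x => ?_⟩
  rw [hα]
  exact solitonBridge_nf_generator_conj hu L hconj ht x (hgen t ht (L.symm x))

end Summit.NavierStokesRegularity.NavierStokesRegularity.Theorems

end
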